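import Summits.QuantumFields.BalabanUV.T4Continuum.Support.NE9ChannelSum
import Summits.QuantumFields.BalabanUV.T4Continuum.Support.NE9Lemma1CurveSpecies
import Summits.QuantumFields.BalabanUV.T4Continuum.Support.NE9Lemma1KernelSpecies

/-!
# NE9LinSizeEndCurKer — E5′-SUM-SPECIES: the d-currency torus END face of row NE9 at the frame's ASSEMBLED TWO-SPECIES CHANNEL
# `cpieceChannel Dc.toC + cpieceChannel K.toC` — species (a) the fifth-order remainder along the Lemma-4 slice curves (`CurData`,
# owner gen 25 part 2) ⊕ species (b) the point-localized terms of [I] §4 (`KerData`, owner gen 25) — with S2 / S-LOC / S-SUM / S5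
# KERNEL for BOTH species BY NAME and the channel-sum assembly of crew row (w25) (cell `pub-balaban`, T4-DAG §2 node U3 / §6 NE9;
# rung (B)+1 on a FIXED finite T⁴; NE9 formalisation crew, unit `b2b-balaban-t4-ne9-formalise-leaf-07` gen 5, CLAIMS.log l.10679 —
# the item the row owner's gen-25 closing l.10614 lists «if no crew seat takes it»; nothing of any import modified, no END re-wired)

HONEST FRAMING (T4-DAG PAGE 1).  Rung (B)+1 = existence and uniqueness of the ε → 0 limit of gauge-invariant observables on a
FIXED finite torus T⁴ — NOT infinite volume, NOT a mass gap, NOT the Clay problem.  NE9 is a cell NEW ESTIMATE, NOT PRINTED and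
NOT discharged here («NE9 ⇐ the named binders»).  Everything kernel here is FORM-LEVEL: the two species are the owner's
`CurData.toC` and `KerData.toC`; that Bałaban's localized curly bracket (1.33) IS their sum with these letters is O-NE9-1 (NODE O)
plus the three displayed IDENTIFICATION binders below — NOT claimed.  [I]/[II] locators are TYPE locators (ABSOLUTE RULE);
`FlowStep.BetaPertH`, (B), (B^μ) do not occur.  HONEST DEPENDENCY (verbatim): continuum YM on T⁴ ⇐ BetaPertH ∧ nine spine
estimates (0/9 proved); BetaPertH ⇐ (D1) ∧ (D4) ∧ CAP+tail; G-an2-4 gates asym, D1 and NE2/3/4.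

WHAT IS PROVED (kernel; ONE composition BY NAME, 0 `def`, 0 sorry).
**`torus_termSize_ne9_and_fadingMemory_of_linSizeDischargers_curKer`** = `NE9ChannelSum.torus_termSize_ne9_and_fadingMemory_of_
linSizeDischargers_sum` (p214415 §3) at `Ta := cpieceChannel Dc.toC`, `Tb := cpieceChannel K.toC`, `Adm := analyticClass Dc.R`, with,
PER SPECIES and BY NAME: S-LOC/S-SUM/S2 (`structureBinders_cur`, `structureBinders_ker`), S5 (`channelSizeAtStepNN_cur` — Lemma 4
TYPE + gain ℓ⁵ —, `channelSizeAtStepNN_ker` — the TWO-RATE binder (K)/(G)/(S) of [I] p. 286 at the input rate κ with the counts at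
κ − w), the profiles `tauOfG cQa (agePow ωa)` / `tauOfG cQb (agePow ωb)` assembled by `profile_tauOfG_add`, and the COMMON output
weight `weightOf Dc.toC.frame κ₁ d₀ O1 (Dc.Kp c_dir + K.Kp cK w₀ c₀ c₁)` by `channelSizeAtStepNN_add_cpiece` (p214415 §4).
DISPLAYED: the two data's admissibility binders (`CurData.Admissible`, `KerData.Admissible` — TYPE), the two level counts, S1 on
`analyticClass Dc.R`, S3 PER SPECIES (`PieceAdditiveOn (analyticClass ·.R) ·.toC` — crew rows (w19)/(w23)), the IDENTIFICATIONS
`hR : K.R = Dc.R` (one family of analyticity radii R_X of U^c_j(X)), `hκ₁ : K.κ₁ = Dc.κ₁` (one κ₁ of [II] (1.10)), `hdY : K.toC.frame.dY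
= Dc.toC.frame.dY` (one d_k(Y)) and the SAME letters d₀, O1 in both counts (both species are pieces of ONE (1.23)-localization of
ONE expansion (3.34) — [II] p. 7 «a sum over all admissible □₀, Y₀, j and X»), `Factorises` / `LastCouplingLipschitz` at the sum, and
every activity / geometry / (A″) / (L‴) binder of E5′ VERBATIM.  Rate letter of the face: **`μ = max ωa ωb + 4·lipbar·(a₁·e^{−a″(ν+1)})
·(cQa + cQb)`** — with ωa = L⁻¹, ωb = L^{−β} ([I] p. 288) the frame fades at L^{−β} (O-ne9p1g23-1), channel weight c_Qa + c_Qb.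
DISGUISE TEST: one-history statements about the sum of two linear channels of ONE run; the fading SOURCE, not NE9.

References (TYPE locators only): T. Bałaban, CMP **109** (1987) [Balaban1987RG1] (0.29)–(0.30) p. 258, (1.18) p. 263, (3.34) p. 277,
Lemma 4 (3.53)–(3.54) p. 280, (4.18) p. 285, (4.22) p. 286, p. 288; CMP **116** (1988) [Balaban1988RG2Cluster] (1.10) p. 4,
(1.23)–(1.29) pp. 7–8, (1.33)–(1.36) p. 9, (2.27) p. 18, (2.38) p. 20, (2.41) p. 21; R. Kotecký, D. Preiss, CMP **103** (1986) [KoteckyPreiss1986].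
-/

noncomputable section

namespace Summit.QuantumFields.BalabanUV.T4Continuum.NE9LinSizeEndCurKer

open scoped BigOperators
open Metric Set MeasureTheory BoundedContinuousFunction
open Literature.Probability.LatticeModels
open Literature.MathematicalPhysics.QuantumFieldTheory
open Literature.MathematicalPhysics.QuantumFieldTheory.Balaban1983to89
open Literature.MathematicalPhysics.QuantumFieldTheory.Balaban1983to89.T4OutputRate
open Literature.MathematicalPhysics.QuantumFieldTheory.Balaban1983to89.T4ActivityLipschitz
open Literature.MathematicalPhysics.QuantumFieldTheory.Balaban1983to89.T4HistoryLipschitzRecursion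
open Literature.MathematicalPhysics.QuantumFieldTheory.Balaban1983to89.T4HistoryLipschitzOuter
open Literature.MathematicalPhysics.QuantumFieldTheory.Balaban1983to89.T4HistoryLipschitzActivity
open Literature.MathematicalPhysics.QuantumFieldTheory.Balaban1983to89.T4HistoryLipschitzEntropy
open Literature.MathematicalPhysics.QuantumFieldTheory.Balaban1983to89.T4HistoryLipschitzCubeGeometry
open Literature.MathematicalPhysics.QuantumFieldTheory.Balaban1983to89.T4HistoryLipschitzActivity (ClusterGeom)
open Literature.MathematicalPhysics.QuantumFieldTheory.Balaban1983to89.T4HistoryLipschitzSegment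
open Literature.MathematicalPhysics.QuantumFieldTheory.Balaban1983to89.T4HistoryLipschitzLinearSize
open Summit.QuantumFields.BalabanUV.T4Continuum.NE9Lemma1Counting
open Summit.QuantumFields.BalabanUV.T4Continuum.NE9Lemma1Gain
open Summit.QuantumFields.BalabanUV.T4Continuum.NE9Lemma1PieceClass
open Summit.QuantumFields.BalabanUV.T4Continuum.NE9ComplexEncoding (doubleCarriers)
open Summit.QuantumFields.BalabanUV.T4Continuum.NE9Lemma1RemainderSpecies
open Summit.QuantumFields.BalabanUV.T4Continuum.NE9Lemma1CurveSpecies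
open Summit.QuantumFields.BalabanUV.T4Continuum.NE9Lemma1KernelSpecies
open Summit.QuantumFields.BalabanUV.T4Continuum.NE9LinSizeEnd
open Summit.QuantumFields.BalabanUV.T4Continuum.NE9ChannelSum

variable {ν N : ℕ} {C : Carriers} {D : ℕ}
variable {Bg : Type} [NormedAddCommGroup Bg] [NormedSpace ℂ Bg] {Sp : Type*} [TopologicalSpace Sp] [MeasurableSpace Sp]
  [OpensMeasurableSpace Sp] {F : Type*} [Fintype F] {Ω : Type*} [MeasurableSpace Ω]

/-- **E5′-SUM-SPECIES — THE d-CURRENCY END AT THE ASSEMBLED TWO-SPECIES CHANNEL (kernel composition BY NAME).**  See the module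
docstring: `NE9ChannelSum.…_sum` at `cpieceChannel Dc.toC + cpieceChannel K.toC` on `analyticClass Dc.R`, with S-LOC/S-SUM/S2/S5 per
species by the owner's `structureBinders_cur`/`_ker`, `channelSizeAtStepNN_cur`/`_ker`, the profile by `profile_tauOfG_add`, the common
weight by `channelSizeAtStepNN_add_cpiece`; displayed: the two admissibility binders (TYPE), the two counts, S1, S3 per species
((w19)/(w23)), the identifications `hR`/`hκ₁`/`hdY`, S4/(L) at the sum, E5′'s activity/geometry side VERBATIM.  Rate letter
`max ωa ωb + 4·lipbar·(a₁·e^{−a″(ν+1)})·(cQa + cQb)`. [cite: Balaban1987RG1, (0.29)-(0.30) p.258, (1.18) p.263, (3.53)-(3.54) p.280, (4.22) p.286, p.288; Balaban1988RG2Cluster, (1.23)-(1.29) pp.7-8, (1.33)-(1.36) p.9, (2.27) p.18, (2.38) p.20, (2.41) p.21; KoteckyPreiss1986, (1)-(3)] -/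
theorem torus_termSize_ne9_and_fadingMemory_of_linSizeDischargers_curKer
    (Γ : CubeChart (doubleCarriers C) (Fin ν → ZMod N) (torusAdj ν N) D) {ι αa βa γa δa αb βb γb δb Pt : Type}
    [DecidableEq δa] [DecidableEq δb]
    (Dc : CurData C Bg ι αa βa γa δa) (K : KerData C Bg ι αb βb γb δb Pt)
    {ℓr : ℕ → ℕ → ℝ} {cdir d0 : ℝ} {ℓk gain : ℕ → ℕ → ℝ} {cK δ₀ δ₁ w w0 c0 c1 : ℝ}
    {E : Functional (doubleCarriers C) Bg} {W : Set (ℕ → ℝ)}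
    {Ψ : ℕ → ℝ → (ι → ℝ) → Bg → (doubleCarriers C).Dom → ℝ}
    {μ : ℕ → ℝ → Bg → Finset (Fin ν → ZMod N) → Measure Ω} {pre : ℕ → ℝ → Bg → Finset (Fin ν → ZMod N) → Ω → ℂ}
    {c : ℕ → ℝ → Bg → Finset (Fin ν → ZMod N) → Ω → F → ℂ}
    {pt : ℕ → ℝ → Bg → Finset (Fin ν → ZMod N) → Ω → F → Sp} {β : ℕ → Sp → ℝ}
    {dom : ℕ → Finset (Fin ν → ZMod N) → F → Finset (Fin ν → ZMod N)}
    {lip ε' α4 : ℕ → ℝ} {a₁ a'' κ O1 cQa cQb ωa ωb lipbar ℓ a a' : ℝ}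
    {lam p₀ Nsz : ℕ → ℝ}
    (ρ : ℕ → (ι → ℝ) → (Sp →ᵇ ℂ))
    -- species (a): the CURVE species — admissible datum (Lemma 4 (3.53) TYPE, gain, radii, G1), scale letter, counts, S3 ((w19))
    (hD : Dc.Admissible ℓr cdir d0) (hℓr : ∀ k j, 0 ≤ ℓr k j)
    (hLa : LevelCountsG Dc.toC.frame κ Dc.κ₁ O1 cQa (fun k j => ℓr k j ^ 5) (agePow ωa))
    (hAa : PieceAdditiveOn (analyticClass Dc.R) Dc.toC) (hcQa : 0 ≤ cQa) (hωa : 0 < ωa)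
    -- species (b): the KERNEL species — admissible datum ((K) p. 286 TYPE, (G), (S), G1), counts at the OUTPUT rate κ − w, S3 ((w23))
    (hK : K.Admissible ℓk gain cK δ₀ δ₁ w w0 c0 c1 d0)
    (hLb : LevelCountsG K.toC.frame (κ - w) K.κ₁ O1 cQb gain (agePow ωb))
    (hAb : PieceAdditiveOn (analyticClass K.R) K.toC) (hcQb : 0 ≤ cQb) (hωb : 0 ≤ ωb)
    -- the IDENTIFICATIONS: one family of analyticity radii, one κ₁, one d_k(Y) (and the same letters d₀, O1 above)
    (hR : K.R = Dc.R) (hκ₁ : K.κ₁ = Dc.κ₁) (hdY : K.toC.frame.dY = Dc.toC.frame.dY) (hO1 : 0 ≤ O1)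
    -- S1 on the analytic class and scale-zero freeness
    (h0 : ScaleZeroFree E W) (hAdm : AdmissibleTerms E W (analyticClass Dc.R))
    -- S4 / (L) and R1 at the assembled channel with the COMMON output weight (displayed, as in every E5′ face)
    (hfac : Factorises E W (cpieceChannel Dc.toC + cpieceChannel K.toC) Ψ)
    (hlast : LastCouplingLipschitz E W (cpieceChannel Dc.toC + cpieceChannel K.toC) Ψ κ lam)
    (hρ : ∀ (k : ℕ) (P P' : ι → ℝ) (M : ℝ),
      (∀ y, |P y - P' y| ≤ weightOf Dc.toC.frame Dc.κ₁ d0 O1 (Dc.Kp cdir + K.Kp cK w0 c0 c1) k y * M) → ‖ρ k P - ρ k P'‖ ≤ M)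
    (hΨ : ∀ (k : ℕ) (s : ℝ) (P P' : ι → ℝ) (U : Bg) (X : (doubleCarriers C).Dom),
      Ψ k s P U X - Ψ k s P' U X =
        (Γ.geom.newTerm (Γ.geom.avgExpLinearAct μ pre fun k s U γ ω => evalFunctional (c k s U γ ω) (pt k s U γ ω))
            k s U X (ρ k P) -
          Γ.geom.newTerm (Γ.geom.avgExpLinearAct μ pre fun k s U γ ω => evalFunctional (c k s U γ ω) (pt k s U γ ω))
            k s U X (ρ k P')).re)
    (hexpl : ∀ g ∈ W, ∀ (k : ℕ) (P : ι → ℝ) (U : Bg) (X : (doubleCarriers C).Dom), (doubleCarriers C).scale X = k + 1 →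
      |Ψ k (g k) P U X -
          (Γ.geom.newTerm (Γ.geom.avgExpLinearAct μ pre fun k s U γ ω => evalFunctional (c k s U γ ω) (pt k s U γ ω))
            k (g k) U X (ρ k P)).re| ≤ Real.exp (-(κ * (doubleCarriers C).d X)) * p₀ k)
    (hbase : ∀ g ∈ W, ∀ (U : Bg) (X : (doubleCarriers C).Dom), (doubleCarriers C).scale X = 0 → |E g U X| ≤ Real.exp (-(κ * (doubleCarriers C).d X)) * Nsz 0)
    (hNsucc : ∀ j, p₀ j + a₁ * Real.exp (-(a'' * (ν + 1))) ≤ Nsz (j + 1)) (hNnn : ∀ j, 0 ≤ Nsz j)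
    (hbox : ∀ (k : ℕ) (P : ι → ℝ), (∀ y, |P y| ≤ weightOf Dc.toC.frame Dc.κ₁ d0 O1 (Dc.Kp cdir + K.Kp cK w0 c0 c1) k y *
      sizeRadius (tauOfG cQa (agePow ωa) + tauOfG cQb (agePow ωb)) Nsz k) → ∀ x, ‖ρ k P x‖ ≤ β k x)
    -- activity side (verbatim E5′)
    (hpre : ∀ k s U γ, AEStronglyMeasurable (pre k s U γ) (μ k s U γ))
    (hc : ∀ k s U γ Y, AEStronglyMeasurable (fun ω => c k s U γ ω Y) (μ k s U γ))
    (hpt : ∀ k s U γ Y, Measurable fun ω => pt k s U γ ω Y) (hlip : ∀ k, 0 < lip k) (hlipb : ∀ k, lip k ≤ lipbar)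
    (hint₀ : ∀ k s U γ, Integrable (fun ω => ‖pre k s U γ ω‖ * Real.exp (boxExponent c pt β k s U γ ω)) (μ k s U γ))
    (hmeet : ∀ k s U (γ : Finset (Fin ν → ZMod N)) ω Y, c k s U γ ω Y ≠ 0 → ∃ x ∈ γ, x ∈ dom k γ Y)
    (hα4 : ∀ k, 0 ≤ α4 k) (ha : (2:ℝ) ^ ν * Real.log 2 + Real.log (8 * ν) ≤ a)
    (hliplb : ∀ k, α4 k * 2 ^ (ν + 1 + 2 ^ ν) ≤ lip k)
    (hlin : ∀ k s U (γ : Finset (Fin ν → ZMod N)) ω Y,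
      ‖c k s U γ ω Y‖ ≤ α4 k * Real.exp (-(a * (linSize (dom k γ Y) : ℝ))))
    (hdomconn : ∀ k (γ : Finset (Fin ν → ZMod N)) Y, (dom k γ Y).Nonempty →
      ∃ b ∈ dom k γ Y, Polymer.IsConn (torusAdj ν N) (dom k γ Y) b)
    (hdominj : ∀ k (γ : Finset (Fin ν → ZMod N)), Set.InjOn (dom k γ) {Y | (dom k γ Y).Nonempty})
    (hXconn : ∀ X, ∃ b, Polymer.IsConn (torusAdj ν N) (Γ.cubes X) b)
    (hcmp : ∀ X, κ * (doubleCarriers C).d X ≤ a'' * (linSize (Γ.cubes X) : ℝ))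
    (hε' : ∀ k, 0 ≤ ε' k)
    (hdecayLin : ∀ g ∈ W, ∀ (k : ℕ) (U : Bg) (X : (doubleCarriers C).Dom), (doubleCarriers C).scale X = k + 1 → ∀ γ' ∈ Γ.vol X,
      ∫ ω, ‖pre k (g k) U γ' ω‖ * Real.exp (boxExponent c pt β k (g k) U γ' ω) ∂(μ k (g k) U γ') ≤
        ε' k * Real.exp (-(a' * (linSize γ' : ℝ))))
    (ha₁ : 0 ≤ a₁) (ha'' : 0 ≤ a'')
    (hrate : (2:ℝ) ^ ν * Real.log 2 + Real.log (8 * ν) ≤ a' - a'' - 2 ^ ν * (a₁ + Real.log 2))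
    (hsmall : ∀ k, ((D : ℝ) + 1) * (2 * ε' k) * Real.exp (a'' * (ν + 1) + 2 ^ ν * (a₁ + Real.log 2)) *
      2 ^ (ν + 1 + 2 ^ ν) ≤ a₁)
    (hℓ : 0 ≤ ℓ) (hlam : ∀ k, lam k ≤ ℓ) :
    TermSize E W κ Nsz ∧
      NE9 E W κ (prodModuli ℓ fun _ => max ωa ωb + 4 * lipbar * (a₁ * Real.exp (-(a'' * (ν + 1)))) * (cQa + cQb)) ∧
        FadingMemory (ℓ / (max ωa ωb + 4 * lipbar * (a₁ * Real.exp (-(a'' * (ν + 1)))) * (cQa + cQb)))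
          (max ωa ωb + 4 * lipbar * (a₁ * Real.exp (-(a'' * (ν + 1)))) * (cQa + cQb))
          (prodModuli ℓ fun _ => max ωa ωb + 4 * lipbar * (a₁ * Real.exp (-(a'' * (ν + 1)))) * (cQa + cQb)) := by
  -- species (a): structure + S5 on the analytic class (owner gen 25 part 2, BY NAME)
  have hSa := structureBinders_cur hD (analyticClass Dc.R)
  have hcQℓa : ∀ k j, 0 ≤ cQa * agePow ωa k j := fun k j => mul_nonneg hcQa (agePow_nonneg hωa.le k j)
  have hstepa := channelSizeAtStepNN_cur hD hℓr κ hLa hO1 hcQℓa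
  -- species (b): structure + S5 (two-rate) on the analytic class, transported along the identifications
  have hSb := structureBinders_ker hK (analyticClass Dc.R)
  have hcQℓb : ∀ k j, 0 ≤ cQb * agePow ωb k j := fun k j => mul_nonneg hcQb (agePow_nonneg hωb k j)
  have hstepb₀ := channelSizeAtStepNN_ker hK κ hLb hO1 hcQℓb
  rw [hR, hκ₁] at hstepb₀
  have hAb' : ChannelAdditive (analyticClass Dc.R) (cpieceChannel K.toC) := by
    have := channelAdditive_ker_of_pieceAdditive hAb
    rwa [hR] at this
  -- the assembled S-binders: common weight (p214415 §4), additivity / step-sum of the sum (§1), the summed profile (§2)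
  have hstep := channelSizeAtStepNN_add_cpiece Dc.toC K.toC hdY hstepa hstepb₀ (kp_nonneg hD) (kp_nonneg_ker hK) hO1
    (fun k j _ => hcQℓa k j) (fun k j _ => hcQℓb k j)
  have hadd := channelAdditive_add (channelAdditive_cur_of_pieceAdditive hAa) hAb'
  have hsum := channelStepSum_add hSa.2.1 hSb.2.1
  have hτ := profile_tauOfG_add hcQa hcQb hωa.le hωb
  -- envelope letters and `hpos`
  have hω : 0 ≤ max ωa ωb := hωa.le.trans (le_max_left _ _)
  have hτbar : 0 ≤ cQa + cQb := add_nonneg hcQa hcQb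
  have hlipbar : 0 ≤ lipbar := (hlip 0).le.trans (hlipb 0)
  have hpos : 0 < max ωa ωb + 4 * lipbar * (a₁ * Real.exp (-(a'' * (ν + 1)))) * (cQa + cQb) := by
    have h2 : 0 ≤ 4 * lipbar * (a₁ * Real.exp (-(a'' * (ν + 1)))) * (cQa + cQb) := by positivity
    have h3 : 0 < max ωa ωb := hωa.trans_le (le_max_left _ _)
    linarith
  exact torus_termSize_ne9_and_fadingMemory_of_linSizeDischargers Γ ρ h0 hAdm hSa.2.2 hadd hsum hstep hfac hlast hρ hΨ hexpl
    hbase hNsucc hNnn hbox hpre hc hpt hlip hlipb hint₀ hmeet hα4 ha hliplb hlin hdomconn hdominj hXconn hcmp hε' hdecayLin ha₁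
    ha'' hrate hsmall hℓ hτbar hω hpos hlam hτ

end Summit.QuantumFields.BalabanUV.T4Continuum.NE9LinSizeEndCurKer

end
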